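import Literature.NumberTheory.EllipticCurves.Gamma0AwayCharacterExtensionProofs
import HarnessLib

/-!
# E-es-43 `gamma0Away_character_extension_of_shiftInvariant` is a THEOREM — stub 3 of line `kato_shift_two`
# BY NAME

Summit `BirchSwinnertonDyer`, route `ManinLocalTwoThree` (cell bsd-f2-manin), deciding crux C2 `ManinOddAtFour`
(stmt-BirchSwinnertonDyer-22967), line `kato_shift_two` v8 (lead p1), **stub 3 `stub_gamma0AwayExtensionFact :
Literature.NumberTheory.EllipticCurves.gamma0Away_character_extension_of_shiftInvariant`** — es's candidate E-es-43
(MEMO-es §25.10 (V-d): the abelianised Bass–Serre amalgam `Γ₀(L′; ℤ[1/t]) = Γ₀(L′) *_{Γ₀(tL′)} diag(t,1)⁻¹Γ₀(L′)diag(t,1)`),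
filed by -ty as a statement-only Literature fact (p606261, «derived reading» of Serre's segment criterion).  The fact is
now DISCHARGED in Literature (`gamma0Away_character_extension_of_shiftInvariant_holds`,
`Literature/NumberTheory/EllipticCurves/Gamma0AwayCharacterExtensionProofs.lean`, with
`…/Gamma0AwayTreeCoordinates.lean`, `…/Gamma0AwayPingPong.lean`, `…/Gamma0AwayGeneration.lean` and the abstract
ping-pong criterion `Literature/GroupTheory/CombinatorialGroupTheory/AmalgamPingPongCharacter.lean`): the amalgam
`Γ₀(L′) *_{Γ₀(L′t)} Γ₀(L′) → SL₂(ℤ[1/t])`, `(γ, γ′) ↦ ιγ · θ(ιγ′)`, reduced words acting by ping-pong on the half-trees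
of the Bruhat–Tits tree written in `t`-adic row coordinates, plus generation of `Γ₀(L′; ℤ[1/t])` by the two vertex
stabilisers.  This file records the registered stub BY NAME, exactly as the skeleton of record states it.

Axioms `propext`, `Classical.choice`, `Quot.sound`; no definitions.  Nothing about BSD or Manin's conjecture is proved
here (one of five stubs of the line; Kato F♯, F-es-27′, E-es-40 and the reducible residual Rb remain).
References: J.-P. Serre, *Trees* (1980) I §4.1 Thm. 6, II §1.4 Thm. 3; cell memo HOME/MEMO-es.md §25.10 (E-es-43).
-/

-- the gate's namespace `Summit.BirchSwinnertonDyer.BirchSwinnertonDyer.…` repeats the summit name (single-conjunct summit)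
set_option linter.dupNamespace false

namespace Summit.BirchSwinnertonDyer.BirchSwinnertonDyer.Theorems

/-- **Stub 3 of line `kato_shift_two` (crux `ManinOddAtFour`, stmt-BirchSwinnertonDyer-22967) BY NAME**: the named
Literature fact E-es-43 `gamma0Away_character_extension_of_shiftInvariant` holds — a `t`-shift-invariant additive
character of `Γ₀(L′)` extends additively to `Γ₀(L′; ℤ[1/t])` (`t` prime, `t ∤ L′`, any field).
[cite: SerreTrees1980, Ch. I §4.1 Thm. 6 and Ch. II §1.4 Thm. 3] -/
theorem stub_gamma0AwayExtensionFact :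
    Literature.NumberTheory.EllipticCurves.gamma0Away_character_extension_of_shiftInvariant :=
  Literature.NumberTheory.EllipticCurves.gamma0Away_character_extension_of_shiftInvariant_holds

end Summit.BirchSwinnertonDyer.BirchSwinnertonDyer.Theorems
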